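import Summits.QuantumFields.BalabanUV.Beta.EriceFlowEnclosureB12AsPrintedPointwiseFadingZeroHistoryBoundary

/-!
# Beta / EriceFlowEnclosureB12AsPrintedPointwiseFadingZeroHistoryBoundaryWitness — part 13c: AT `b⋆ = 0` NEITHER THE LETTERS NOR THE SIGN DECIDE ROW (iv); THE CARRIER OF THE
# NEGATIVITY DOES.  Two families carrying ALL of node U2's letters (`HistLipschitz` ∕ `FadingMemory` ∕ NE4 `ScaleShiftRate`), part 11's asymptotic constant **`b⋆ = 0`** and part 13's
# zero-history values:
# (A) `β_{k+1} ≡ −cθ^k` (c > 0, 0 < θ < 1): NEGATIVE AT EVERY SCALE AND EVERY POINT, zero-history values `b⁰_k = −cθ^k`, history term ≡ 0 — and the END-grade carrier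
#     `BetaPartialSumsLowerH (c∕(1−θ)) δ β` at EVERY level δ (part 13b's summable envelope): scale-carried negativity is harmless;
# (B) `β_{k+1}(g_{≤k}) = −a·g_k²` (a > 0): zero-history values `b⁰ ≡ 0` (β IS its history term), `|β| ≤ aδ²` on ]0, δ] — as small as one likes near zero coupling — and NO run-wise
#     partial-sum floor at ANY level for ANY M (part 13b's (K2): the negativity is bounded away from zero on every cube [η, δ]^{k+1}): coupling-carried negativity is fatal.
# With part 12c (`−a·g_k`, the same mechanism one power lower) and part 12d (`b⋆ < 0` always fatal, `b⋆ > 0` always sufficient): the boundary `b⋆ = 0` is decided EXACTLY by the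
# run-wise floor of the history term `β_{k+1}(v) − b⁰_k` (part 13b §1), and by nothing coarser — not by the letters, not by the sign of β, not by the size of |β| near zero.
# (C) `β_{k+1}(g_{≤k}) = a·θ^k·g_0`: the letters ALLOW A FADING MEMORY OF THE BARE COUPLING — all letters, `b⋆ = 0`, `b⁰ ≡ 0`, part 13's fading corner bound attained by its `i = 0`
#     term, and NO last-coupling bound `|β_{k+1}(v) − b⁰_k| ≤ C_r·v_k` for any `C_r`: the fading (AF-1) is the intrinsic one; the printed last-coupling shape is an extra letter.
# (β-flow team, prover 2 = lower ∕ positivity side, unit `b2b-balaban-beta-bflow-p2`, gen 51; witness part of part 13)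

HONEST FRAMING (page 1 of everything the β sub-cell writes): discharging `BetaPertH` makes Bałaban's UV stability UNCONDITIONAL — a
real constructive-QFT result; it is NOT the continuum limit and NOT the Clay problem.  HONEST DEPENDENCY (cell reorg 2026-08-19,
verbatim): «continuum YM on T⁴ ⇐ BetaPertH ∧ nine spine estimates (0/9 proved); BetaPertH ⇐ (D1) ∧ (D4) ∧ CAP+tail; G-an2-4 gates
asym, D1 and NE2/3/4.»  THIS MODULE DISCHARGES NOTHING: three TOYS written as lambdas (NOT Bałaban's β — the physical flow has `b⋆ > 0` if [I] Theorem 2 holds as typed, part 11c);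
node U2's `LastOnlyLipschitz` ∕ `histLipschitz_of_lastOnly` ∕ `fadingMemory_diag` ∕ `betaInf`, part 13b's `betaPartialSumsLowerH_of_summableNeg` ∕ `no_runPS_of_negAwayFromZero` and
pub-balaban-gaps' `runwisePS_of_betaPartialSumsLowerH` BY NAME.  Census value only: it records which structure of a β-family K1⁹'s row (iv) reads at the boundary.

WHAT THIS FILE PROVES (0 sorry, 0 def):
§1 (A) `histLipschitz_negGeom`, `fadingMemory_zero`, `scaleShiftRate_negGeom` (∕ `_sharp`), `zeroHist_rate_sharp_negGeom` (part 13's rate cθ^k∕(1−θ) is ATTAINED), `betaInf_negGeom`, `bstar_zero_negGeom`,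
   `zeroHist_negGeom`, **`betaPartialSumsLowerH_negGeom`** (every level).
§2 (B) `lastOnlyLipschitz_negSq`, `histLipschitz_negSq`, `scaleShiftRate_negSq`, `betaInf_negSq`, `bstar_zero_negSq`, `zeroHist_negSq`, **`no_runPS_negSq`** (every level, every M),
   `not_betaPartialSumsLowerH_negSq`.
§3 (C) `histLipschitz_bareMemory`, `fadingMemory_bareMemory`, `scaleShiftRate_bareMemory`, `bstar_zero_bareMemory`, `zeroHist_bareMemory`, **`no_lastCoupling_AF1_bareMemory`**.
§4 **`boundary_decided_by_history_term`** — the headline: families (A) and (B) side by side.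
NOT CLAIMED: anything about Bałaban's β; which side any concrete scheme is on; K1⁹; `BetaPertH`; continuum; Clay.
-/

namespace Summit.QuantumFields.BalabanUV.Beta.EriceFlowEnclosureB12AsPrintedPointwiseFadingZeroHistoryBoundaryWitness

open Finset Filter Topology
open Literature.MathematicalPhysics.QuantumFieldTheory.Balaban1983to89
open Literature.MathematicalPhysics.QuantumFieldTheory.Balaban1983to89.FlowStep (HBeta prefixOf Box mem_box RGEqH)
open Literature.MathematicalPhysics.QuantumFieldTheory.Balaban1983to89.FlowStepRuns (BetaPartialSumsLowerH)
open Literature.MathematicalPhysics.QuantumFieldTheory.Balaban1983to89.T4CouplingMatching (HistLipschitz FadingMemory ScaleShiftRate LastOnlyLipschitz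
  histLipschitz_of_lastOnly fadingMemory_diag)
open Literature.MathematicalPhysics.QuantumFieldTheory.Balaban1983to89.T4BetaStationary (revHist betaInf)
open Summit.QuantumFields.BalabanUV.Gaps.EndRunwiseCone (runwisePS_of_betaPartialSumsLowerH)
open Summit.QuantumFields.BalabanUV.Beta.EriceFlowEnclosureB12AsPrintedPointwiseFadingZeroHistoryBoundary (betaPartialSumsLowerH_of_summableNeg
  no_runPS_of_negAwayFromZero)

noncomputable section

/-! ## §1 (A) `β_{k+1} ≡ −cθ^k`: all letters, `b⋆ = 0`, negative everywhere — and the carrier at every level -/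

/-- A history-free family has node U2's modulus with the ZERO moduli on every box. [folklore] -/
theorem histLipschitz_negGeom (c θ γ : ℝ) : HistLipschitz (fun _ _ => 0) γ (fun k (_ : Fin (k + 1) → ℝ) => -c * θ ^ k) := by
  intro k p q _ _
  simp

/-- The zero moduli fade at every rate with constant 0. [folklore] -/
theorem fadingMemory_zero (θ : ℝ) : FadingMemory 0 θ (fun _ _ => (0 : ℝ)) := fun _ _ _ => ⟨le_rfl, by simp⟩

/-- NE4 for `−cθ^k` (0 ≤ c, 0 ≤ θ ≤ 1): `|−cθ^{k+1} + cθ^k| = cθ^k(1−θ) ≤ cθ^k`. [folklore] -/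
theorem scaleShiftRate_negGeom {c θ : ℝ} (hc : 0 ≤ c) (hθ0 : 0 ≤ θ) (hθ1 : θ ≤ 1) (γ : ℝ) :
    ScaleShiftRate c θ γ (fun k (_ : Fin (k + 1) → ℝ) => -c * θ ^ k) := by
  intro k w _
  have hθk : 0 ≤ θ ^ k := pow_nonneg hθ0 k
  have e : -c * θ ^ (k + 1) - -c * θ ^ k = c * θ ^ k * (1 - θ) := by ring
  rw [e, abs_of_nonneg (by apply mul_nonneg (mul_nonneg hc hθk); linarith)]
  nlinarith [mul_nonneg hc hθk]

/-- NE4 with the SHARP constant `c(1−θ)` for `−cθ^k` (0 ≤ c, 0 ≤ θ ≤ 1): `|−cθ^{k+1} + cθ^k| = c(1−θ)·θ^k` exactly. [folklore] -/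
theorem scaleShiftRate_negGeom_sharp {c θ : ℝ} (hc : 0 ≤ c) (hθ0 : 0 ≤ θ) (hθ1 : θ ≤ 1) (γ : ℝ) :
    ScaleShiftRate (c * (1 - θ)) θ γ (fun k (_ : Fin (k + 1) → ℝ) => -c * θ ^ k) := by
  intro k w _
  have hθk : 0 ≤ θ ^ k := pow_nonneg hθ0 k
  have e : -c * θ ^ (k + 1) - -c * θ ^ k = c * (1 - θ) * θ ^ k := by ring
  rw [e, abs_of_nonneg (mul_nonneg (mul_nonneg hc (by linarith)) hθk)]

/-- **PART 13's RATE `|b⁰_k − b⋆| ≤ cθ^k∕(1−θ)` IS SHARP**: for `−cθ^k` (0 ≤ c, 0 ≤ θ < 1) with the sharp NE4 constant `c′ = c(1−θ)`, `b⁰_k = −cθ^k` and `b⋆ = 0`, the bound `c′θ^k∕(1−θ)` is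
ATTAINED at every scale: `|b⁰_k − b⋆| = c′θ^k∕(1−θ)`. [folklore] -/
theorem zeroHist_rate_sharp_negGeom {c θ : ℝ} (hc : 0 ≤ c) (hθ0 : 0 ≤ θ) (hθ1 : θ < 1) (k : ℕ) :
    |(-c * θ ^ k) - 0| = c * (1 - θ) * θ ^ k / (1 - θ) := by
  have h1θ : 0 < 1 - θ := by linarith
  rw [sub_zero, neg_mul, abs_neg, abs_of_nonneg (mul_nonneg hc (pow_nonneg hθ0 k))]
  field_simp

/-- node U2's stationary functional of `−cθ^k` is `0` on every history (θ ∈ [0,1[). [folklore] -/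
theorem betaInf_negGeom {c θ : ℝ} (hθ0 : 0 ≤ θ) (hθ1 : θ < 1) (h : ℕ → ℝ) :
    betaInf (fun k (_ : Fin (k + 1) → ℝ) => -c * θ ^ k) h = 0 := by
  unfold betaInf
  have ht : Tendsto (fun k : ℕ => -c * θ ^ k) atTop (𝓝 0) := by
    simpa using (tendsto_pow_atTop_nhds_zero_of_lt_one hθ0 hθ1).const_mul (-c)
  exact ht.limUnder_eq

/-- **PART 11's CONSTANT IS `b⋆ = 0`** for `−cθ^k`, with history constant `C = 0`. [folklore] -/
theorem bstar_zero_negGeom {c θ : ℝ} (hθ0 : 0 ≤ θ) (hθ1 : θ < 1) (γ : ℝ) :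
    ∀ u : ℝ, 0 < u → u ≤ γ → |betaInf (fun k (_ : Fin (k + 1) → ℝ) => -c * θ ^ k) (fun _ : ℕ => u) - 0| ≤ 0 * u / (1 - θ) := by
  intro u _ _
  rw [betaInf_negGeom hθ0 hθ1]
  simp

/-- **PART 13's ZERO-HISTORY VALUES ARE `b⁰_k = −cθ^k`** (history constant `C = 0`): the history term `β_{k+1}(v) − b⁰_k` VANISHES IDENTICALLY. [folklore] -/
theorem zeroHist_negGeom (c θ γ : ℝ) :
    ∀ (k : ℕ) (u : ℝ), 0 < u → u ≤ γ → |(fun k (_ : Fin (k + 1) → ℝ) => -c * θ ^ k) k (fun _ : Fin (k + 1) => u) - (-c * θ ^ k)| ≤ 0 * u / (1 - θ) := by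
  intro k u _ _
  simp

/-- **THE END-GRADE CARRIER AT EVERY LEVEL** for `−cθ^k` (0 ≤ c, 0 ≤ θ < 1): `BetaPartialSumsLowerH (c∕(1−θ)) δ β` on every box — part 13b's summable envelope with `k₀ = 0`, `e_k = cθ^k`
(`Σ_{j<n} cθ^j ≤ c∕(1−θ)`), although the family is negative at every scale and every point when `c, θ > 0`. [folklore] -/
theorem betaPartialSumsLowerH_negGeom {c θ : ℝ} (hc : 0 ≤ c) (hθ0 : 0 ≤ θ) (hθ1 : θ < 1) (δ : ℝ) :
    BetaPartialSumsLowerH (c / (1 - θ)) δ (fun k (_ : Fin (k + 1) → ℝ) => -c * θ ^ k) := by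
  have h1θ : 0 < 1 - θ := by linarith
  have h := betaPartialSumsLowerH_of_summableNeg (β := fun k (_ : Fin (k + 1) → ℝ) => -c * θ ^ k) (δ := δ) (k₀ := 0) (B := 0)
    (e := fun j => c * θ ^ j) (E := c / (1 - θ)) le_rfl (fun j _ hj _ => absurd hj (Nat.not_lt_zero j))
    (fun j _ _ _ => by simp) (fun j => by positivity) (fun n => by
      calc ∑ j ∈ Ico 0 n, c * θ ^ j = c * ∑ j ∈ Ico 0 n, θ ^ j := by rw [mul_sum]
        _ ≤ c * (θ ^ 0 / (1 - θ)) := mul_le_mul_of_nonneg_left (geom_sum_Ico_le_of_lt_one hθ0 hθ1) hc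
        _ = c / (1 - θ) := by rw [pow_zero]; ring)
  simpa using h

/-! ## §2 (B) `β_{k+1} = −a·g_k²`: all letters, `b⋆ = 0`, `b⁰ ≡ 0`, `|β| ≤ aδ²` near zero — and no run-wise floor at any level -/

/-- `−a·g_k²` is last-only Lipschitz with constant `2aδ` on the box ]0, δ] (`|p² − q²| ≤ 2δ|p − q|`). [folklore] -/
theorem lastOnlyLipschitz_negSq {a δ : ℝ} (ha : 0 ≤ a) :
    LastOnlyLipschitz (2 * a * δ) δ (fun k (v : Fin (k + 1) → ℝ) => -a * v (Fin.last k) ^ 2) := by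
  intro k p q hp hq
  have hpk := mem_box.mp hp (Fin.last k)
  have hqk := mem_box.mp hq (Fin.last k)
  have e : -a * p (Fin.last k) ^ 2 - -a * q (Fin.last k) ^ 2 = -(a * (p (Fin.last k) + q (Fin.last k))) * (p (Fin.last k) - q (Fin.last k)) := by
    ring
  rw [e, abs_mul, abs_neg, abs_of_nonneg (by nlinarith)]
  exact mul_le_mul_of_nonneg_right (by nlinarith) (abs_nonneg _)

/-- … hence node U2's modulus with the DIAGONAL moduli `2aδ·[i = k]` on the box ]0, δ] (fading at ANY rate θ ≥ 0 with constant `2aδ`, `fadingMemory_diag`). [folklore] -/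
theorem histLipschitz_negSq {a δ : ℝ} (ha : 0 ≤ a) :
    HistLipschitz (fun k i => if i = k then 2 * a * δ else 0) δ (fun k (v : Fin (k + 1) → ℝ) => -a * v (Fin.last k) ^ 2) :=
  histLipschitz_of_lastOnly (lastOnlyLipschitz_negSq ha)

/-- NE4 at rate ZERO (a last-only family is its own scale shift). [folklore] -/
theorem scaleShiftRate_negSq (a θ γ : ℝ) : ScaleShiftRate 0 θ γ (fun k (v : Fin (k + 1) → ℝ) => -a * v (Fin.last k) ^ 2) := by
  intro k w _
  have htail : Fin.tail w (Fin.last k) = w (Fin.last (k + 1)) := by rw [Fin.tail, Fin.succ_last]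
  simp only [htail, sub_self, abs_zero, zero_mul, le_refl]

/-- node U2's stationary functional on the constant history `(u, u, …)` is `−a·u²`. [folklore] -/
theorem betaInf_negSq (a u : ℝ) : betaInf (fun k (v : Fin (k + 1) → ℝ) => -a * v (Fin.last k) ^ 2) (fun _ : ℕ => u) = -a * u ^ 2 := by
  unfold betaInf
  have h : (fun k : ℕ => (fun k (v : Fin (k + 1) → ℝ) => -a * v (Fin.last k) ^ 2) k (revHist (fun _ : ℕ => u) k)) = fun _ : ℕ => -a * u ^ 2 := by
    funext k; simp [revHist]
  rw [h]
  exact tendsto_const_nhds.limUnder_eq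

/-- **PART 11's CONSTANT IS `b⋆ = 0`** for `−a·g_k²` on the box ]0, δ] (history constant `C = 2aδ`, any rate `0 ≤ θ < 1`): `a·u² ≤ 2aδ·u ≤ 2aδ·u∕(1−θ)`. [folklore] -/
theorem bstar_zero_negSq {a θ δ : ℝ} (ha : 0 ≤ a) (hθ0 : 0 ≤ θ) (hθ1 : θ < 1) :
    ∀ u : ℝ, 0 < u → u ≤ δ → |betaInf (fun k (v : Fin (k + 1) → ℝ) => -a * v (Fin.last k) ^ 2) (fun _ : ℕ => u) - 0| ≤ 2 * a * δ * u / (1 - θ) := by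
  intro u hu huδ
  have h1θ : 0 < 1 - θ := by linarith
  rw [betaInf_negSq, sub_zero, neg_mul, abs_neg, abs_of_nonneg (by positivity), le_div_iff₀ h1θ]
  have hau : 0 ≤ a * u := mul_nonneg ha hu.le
  have h1 : a * u ^ 2 * (1 - θ) ≤ a * u ^ 2 := by nlinarith [mul_nonneg hau hu.le]
  have h2 : a * u ^ 2 ≤ a * u * δ := by nlinarith [mul_le_mul_of_nonneg_left huδ hau]
  have h3 : a * u * δ ≤ 2 * a * δ * u := by nlinarith [mul_nonneg hau (hu.le.trans huδ)]
  linarith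

/-- **PART 13's ZERO-HISTORY VALUES ARE `b⁰ ≡ 0`** for `−a·g_k²` (so β IS its own history term): `|β_{k+1}(u,…,u) − 0| = a·u² ≤ 2aδ·u∕(1−θ)` on ]0, δ]. [folklore] -/
theorem zeroHist_negSq {a θ δ : ℝ} (ha : 0 ≤ a) (hθ0 : 0 ≤ θ) (hθ1 : θ < 1) :
    ∀ (k : ℕ) (u : ℝ), 0 < u → u ≤ δ →
      |(fun k (v : Fin (k + 1) → ℝ) => -a * v (Fin.last k) ^ 2) k (fun _ : Fin (k + 1) => u) - 0| ≤ 2 * a * δ * u / (1 - θ) := by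
  intro k u hu huδ
  have h1θ : 0 < 1 - θ := by linarith
  simp only [sub_zero, neg_mul, abs_neg]
  rw [abs_of_nonneg (by positivity), le_div_iff₀ h1θ]
  have hau : 0 ≤ a * u := mul_nonneg ha hu.le
  have h1 : a * u ^ 2 * (1 - θ) ≤ a * u ^ 2 := by nlinarith [mul_nonneg hau hu.le]
  have h2 : a * u ^ 2 ≤ a * u * δ := by nlinarith [mul_le_mul_of_nonneg_left huδ hau]
  have h3 : a * u * δ ≤ 2 * a * δ * u := by nlinarith [mul_nonneg hau (hu.le.trans huδ)]
  linarith

/-- **NO RUN-WISE PARTIAL-SUM FLOOR AT ANY LEVEL** for `−a·g_k²` (a > 0): at every level δ > 0 and for every M some in-window solution of (0.20) has a window sum `< −M` — part 13b's (K2)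
with `k₀ = 0`, `B = aδ²`, `ε(η) = aη²`.  The negativity `|β| ≤ aδ²` is as small as one likes near zero coupling; it is fatal because it is carried by the coupling. [folklore] -/
theorem no_runPS_negSq {a δ : ℝ} (ha : 0 < a) (hδ : 0 < δ) (M : ℝ) :
    ∃ (n : ℕ) (gs : ℕ → ℝ), RGEqH n (fun k (v : Fin (k + 1) → ℝ) => -a * v (Fin.last k) ^ 2) gs ∧ Step.InInterval δ n gs ∧
      ∃ k, k ≤ n ∧ ∑ j ∈ Ico k n, (fun k (v : Fin (k + 1) → ℝ) => -a * v (Fin.last k) ^ 2) j (prefixOf gs j) < -M := by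
  refine no_runPS_of_negAwayFromZero (k₀ := 0) (B := a * δ ^ 2) hδ (by positivity) (fun k v hv => ?_) (fun k v hv => ?_)
    (fun k v _ hv => ?_) (fun η hη => ⟨a * η ^ 2, by positivity, fun k v _ hv hηv => ?_⟩) M
  · have := (mem_box.mp hv (Fin.last k)).1
    have : 0 ≤ a * v (Fin.last k) ^ 2 := by positivity
    have : 0 ≤ a * δ ^ 2 := by positivity
    linarith
  · have h := mem_box.mp hv (Fin.last k)
    have hsq : v (Fin.last k) ^ 2 ≤ δ ^ 2 := pow_le_pow_left₀ h.1.le h.2 2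
    nlinarith
  · have : 0 ≤ a * v (Fin.last k) ^ 2 := by positivity
    linarith
  · have h := hηv (Fin.last k)
    have hsq : η ^ 2 ≤ v (Fin.last k) ^ 2 := pow_le_pow_left₀ hη.le h 2
    nlinarith

/-- … so the END-grade carrier fails at every level for every M. [folklore] -/
theorem not_betaPartialSumsLowerH_negSq {a δ : ℝ} (ha : 0 < a) (hδ : 0 < δ) (M : ℝ) :
    ¬ BetaPartialSumsLowerH M δ (fun k (v : Fin (k + 1) → ℝ) => -a * v (Fin.last k) ^ 2) := by
  intro hps
  obtain ⟨n, gs, hrg, hI, k, hk, hlt⟩ := no_runPS_negSq ha hδ M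
  have h := runwisePS_of_betaPartialSumsLowerH hδ hps n gs hrg hI k hk
  linarith

/-! ## §3 (C) `β_{k+1} = a·θ^k·g_0`: the letters allow a FADING MEMORY OF THE BARE COUPLING — the last-coupling (AF-1) is NOT implied -/

/-- `a·θ^k·g_0` carries node U2's modulus on every box with the moduli `Λ_{k,i} = aθ^k·[i = 0]` (only the bare coupling enters). [folklore] -/
theorem histLipschitz_bareMemory {a θ : ℝ} (ha : 0 ≤ a) (hθ0 : 0 ≤ θ) (γ : ℝ) :
    HistLipschitz (fun k i => if i = 0 then a * θ ^ k else 0) γ (fun k (v : Fin (k + 1) → ℝ) => a * θ ^ k * v 0) := by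
  intro k p q _ _
  have e : ∑ i : Fin (k + 1), (if (i : ℕ) = 0 then a * θ ^ k else 0) * |p i - q i| = a * θ ^ k * |p 0 - q 0| := by
    rw [Fin.sum_univ_succ]
    simp
  rw [e, ← mul_sub, abs_mul, abs_of_nonneg (by positivity)]

/-- … whose moduli FADE at rate θ with constant a (`Λ_{k,0} = aθ^{k−0}`). [folklore] -/
theorem fadingMemory_bareMemory {a θ : ℝ} (ha : 0 ≤ a) (hθ0 : 0 ≤ θ) :
    FadingMemory a θ (fun k i => if i = 0 then a * θ ^ k else 0) := by
  intro k i _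
  by_cases hi : i = 0
  · subst hi
    have h : 0 ≤ a * θ ^ k := by positivity
    simp [h]
  · simp only [hi, if_false]
    exact ⟨le_rfl, by positivity⟩

/-- NE4 for `a·θ^k·g_0` on ]0, γ] (0 ≤ θ ≤ 1): `|aθ^{k+1}w_0 − aθ^k w_1| ≤ 2aγ·θ^k`. [folklore] -/
theorem scaleShiftRate_bareMemory {a θ γ : ℝ} (ha : 0 ≤ a) (hθ0 : 0 ≤ θ) (hθ1 : θ ≤ 1) :
    ScaleShiftRate (2 * a * γ) θ γ (fun k (v : Fin (k + 1) → ℝ) => a * θ ^ k * v 0) := by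
  intro k w hw
  have h0 := mem_box.mp hw 0
  have h1 := mem_box.mp hw 1
  have htail : Fin.tail w 0 = w 1 := rfl
  show |a * θ ^ (k + 1) * w 0 - a * θ ^ k * Fin.tail w 0| ≤ 2 * a * γ * θ ^ k
  rw [htail]
  have hθk : 0 ≤ θ ^ k := pow_nonneg hθ0 k
  have hx : |a * θ ^ (k + 1) * w 0| ≤ a * γ * θ ^ k := by
    rw [abs_of_nonneg (by have := h0.1.le; positivity), pow_succ]
    have : θ * w 0 ≤ 1 * γ := mul_le_mul hθ1 h0.2 h0.1.le zero_le_one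
    nlinarith [mul_nonneg ha hθk]
  have hy : |a * θ ^ k * w 1| ≤ a * γ * θ ^ k := by
    rw [abs_of_nonneg (by have := h1.1.le; positivity)]
    nlinarith [mul_nonneg ha hθk, h1.2]
  calc |a * θ ^ (k + 1) * w 0 - a * θ ^ k * w 1| ≤ |a * θ ^ (k + 1) * w 0| + |a * θ ^ k * w 1| := abs_sub _ _
    _ ≤ 2 * a * γ * θ ^ k := by linarith

/-- The stationary functional of `a·θ^k·g_0` vanishes (θ < 1), so **`b⋆ = 0`** with any history constant `C ≥ 0`. [folklore] -/
theorem bstar_zero_bareMemory {a θ C : ℝ} (hθ0 : 0 ≤ θ) (hθ1 : θ < 1) (hC : 0 ≤ C) (γ : ℝ) :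
    ∀ u : ℝ, 0 < u → u ≤ γ → |betaInf (fun k (v : Fin (k + 1) → ℝ) => a * θ ^ k * v 0) (fun _ : ℕ => u) - 0| ≤ C * u / (1 - θ) := by
  intro u hu _
  have h1θ : 0 < 1 - θ := by linarith
  have hlim : betaInf (fun k (v : Fin (k + 1) → ℝ) => a * θ ^ k * v 0) (fun _ : ℕ => u) = 0 := by
    unfold betaInf
    have h : (fun k : ℕ => (fun k (v : Fin (k + 1) → ℝ) => a * θ ^ k * v 0) k (revHist (fun _ : ℕ => u) k)) = fun k : ℕ => a * u * θ ^ k := by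
      funext k; simp [revHist]; ring
    rw [h]
    have ht : Tendsto (fun k : ℕ => a * u * θ ^ k) atTop (𝓝 0) := by
      simpa using (tendsto_pow_atTop_nhds_zero_of_lt_one hθ0 hθ1).const_mul (a * u)
    exact ht.limUnder_eq
  rw [hlim, sub_zero, abs_zero]
  positivity

/-- **THE ZERO-HISTORY VALUES ARE `b⁰ ≡ 0`** (`|aθ^k u − 0| ≤ a·u ≤ a·u∕(1−θ)` for 0 ≤ θ < 1): β IS its history term, and the FADING corner bound of part 13 holds with its `i = 0` term
ALONE (`a·θ^{k−0}·v_0`) — the bound is attained in shape. [folklore] -/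
theorem zeroHist_bareMemory {a θ : ℝ} (ha : 0 ≤ a) (hθ0 : 0 ≤ θ) (hθ1 : θ < 1) (γ : ℝ) :
    ∀ (k : ℕ) (u : ℝ), 0 < u → u ≤ γ → |(fun k (v : Fin (k + 1) → ℝ) => a * θ ^ k * v 0) k (fun _ : Fin (k + 1) => u) - 0| ≤ a * u / (1 - θ) := by
  intro k u hu _
  have h1θ : 0 < 1 - θ := by linarith
  have hθk : θ ^ k ≤ 1 := pow_le_one₀ hθ0 hθ1.le
  simp only [sub_zero]
  rw [abs_of_nonneg (by positivity), le_div_iff₀ h1θ]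
  have hau : 0 ≤ a * u := by positivity
  have : a * θ ^ k * u ≤ a * u := by nlinarith [mul_nonneg hau (pow_nonneg hθ0 k)]
  nlinarith [mul_nonneg hau hθ0, mul_nonneg (mul_nonneg hau (pow_nonneg hθ0 k)) hθ0]

/-- **THE LAST-COUPLING (AF-1) IS NOT IMPLIED BY THE LETTERS.**  For `a, θ, γ > 0` NO constant `C_r` gives `|β_{k+1}(v) − b⁰_k| ≤ C_r·v_k` on the boxes of `a·θ^k·g_0` (at scale 1 the
history `(γ, t)` has `β = aθγ` but last coupling `t → 0`): the fading form `≤ CΣθ^{k−i}v_i` of part 13 is the intrinsic (AF-1); the printed last-coupling shape needs the history to be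
non-decreasing (`abs_sub_zeroHist_le_last_of_monotone`) or an extra letter. [folklore] -/
theorem no_lastCoupling_AF1_bareMemory {a θ γ : ℝ} (ha : 0 < a) (hθ : 0 < θ) (hγ : 0 < γ) :
    ¬ ∃ Cr : ℝ, ∀ (k : ℕ) (v : Fin (k + 1) → ℝ), v ∈ Box γ k →
      |(fun k (v : Fin (k + 1) → ℝ) => a * θ ^ k * v 0) k v - 0| ≤ Cr * v (Fin.last k) := by
  rintro ⟨Cr, hCr⟩
  set t : ℝ := min γ (a * θ * γ / (2 * (|Cr| + 1))) with ht
  have htpos : 0 < t := lt_min hγ (by positivity)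
  have htγ : t ≤ γ := min_le_left _ _
  have ht2 : t ≤ a * θ * γ / (2 * (|Cr| + 1)) := min_le_right _ _
  set v : Fin (1 + 1) → ℝ := fun i => if (i : ℕ) = 0 then γ else t with hv
  have hvbox : v ∈ Box γ 1 := mem_box.mpr fun i => by
    fin_cases i
    · simp [hv, hγ]
    · simp [hv, htpos, htγ]
  have h := hCr 1 v hvbox
  have hv0 : v 0 = γ := by simp [hv]
  have hv1 : v (Fin.last 1) = t := by simp [hv]
  simp only [hv0, hv1, pow_one, sub_zero] at h
  rw [abs_of_pos (by positivity)] at h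
  have h3 : Cr * t ≤ |Cr| * t := mul_le_mul_of_nonneg_right (le_abs_self Cr) htpos.le
  have h4 : 2 * (|Cr| + 1) * t ≤ a * θ * γ := by rwa [le_div_iff₀ (by positivity), mul_comm] at ht2
  have h5 : 0 < a * θ * γ := by positivity
  nlinarith [abs_nonneg Cr]

/-! ## §4 Headline: at `b⋆ = 0` the carrier of the negativity decides, nothing coarser -/

/-- **THE BOUNDARY `b⋆ = 0` IS DECIDED BY THE HISTORY TERM, NOT BY THE LETTERS, THE SIGN, OR THE SIZE NEAR ZERO.**  (A) There is a family (`−cθ^k`, c = 1, θ = 1∕2) carrying node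
U2's modulus (zero moduli) on every box, fading memory (constant 0), NE4 (constant 1) on every box, part 11's `b⋆ = 0` and part 13's zero-history values `−θ^k` (history term ≡ 0), which
is NEGATIVE at every scale and every history — and has the END-grade carrier `BetaPartialSumsLowerH 2 δ β` at EVERY level δ.  (B) There is a family (`−g_k²`) carrying the modulus on
every box ]0, δ] (diagonal moduli `2δ`), fading memory at every rate, NE4 at rate 0, `b⋆ = 0` and zero-history values `b⁰ ≡ 0` on every box — and NO run-wise partial-sum floor at ANY
level for ANY M.  So across the boundary row (iv) is read off the run-wise floor of the history term `β_{k+1}(v) − b⁰_k` (part 13b §1) and off nothing coarser. [folklore] -/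
theorem boundary_decided_by_history_term :
    (∃ (β : HBeta) (c θ : ℝ), 0 < c ∧ 0 < θ ∧ θ < 1 ∧
      (∀ (k : ℕ) (v : Fin (k + 1) → ℝ), β k v < 0) ∧
      (∀ γ : ℝ, HistLipschitz (fun _ _ => 0) γ β) ∧ FadingMemory 0 θ (fun _ _ => (0 : ℝ)) ∧ (∀ γ : ℝ, ScaleShiftRate c θ γ β) ∧
      (∀ γ u : ℝ, 0 < u → u ≤ γ → |betaInf β (fun _ : ℕ => u) - 0| ≤ 0 * u / (1 - θ)) ∧
      (∀ (γ : ℝ) (k : ℕ) (u : ℝ), 0 < u → u ≤ γ → |β k (fun _ : Fin (k + 1) => u) - (-c * θ ^ k)| ≤ 0 * u / (1 - θ)) ∧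
      ∀ δ : ℝ, BetaPartialSumsLowerH (c / (1 - θ)) δ β) ∧
    (∃ (β : HBeta) (a : ℝ), 0 < a ∧
      (∀ δ : ℝ, HistLipschitz (fun k i => if i = k then 2 * a * δ else 0) δ β) ∧
      (∀ δ θ : ℝ, 0 ≤ δ → 0 ≤ θ → FadingMemory (2 * a * δ) θ (fun k i => if i = k then 2 * a * δ else 0)) ∧
      (∀ θ γ : ℝ, ScaleShiftRate 0 θ γ β) ∧
      (∀ θ δ : ℝ, 0 ≤ θ → θ < 1 → ∀ u : ℝ, 0 < u → u ≤ δ → |betaInf β (fun _ : ℕ => u) - 0| ≤ 2 * a * δ * u / (1 - θ)) ∧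
      (∀ θ δ : ℝ, 0 ≤ θ → θ < 1 → ∀ (k : ℕ) (u : ℝ), 0 < u → u ≤ δ → |β k (fun _ : Fin (k + 1) => u) - 0| ≤ 2 * a * δ * u / (1 - θ)) ∧
      ∀ δ : ℝ, 0 < δ → ∀ M : ℝ, ∃ (n : ℕ) (gs : ℕ → ℝ), RGEqH n β gs ∧ Step.InInterval δ n gs ∧
        ∃ k, k ≤ n ∧ ∑ j ∈ Ico k n, β j (prefixOf gs j) < -M) := by
  refine ⟨⟨fun k (_ : Fin (k + 1) → ℝ) => -1 * (1 / 2 : ℝ) ^ k, 1, 1 / 2, one_pos, by norm_num, by norm_num, fun k v => ?_,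
      fun γ => histLipschitz_negGeom 1 (1 / 2) γ, fadingMemory_zero (1 / 2),
      fun γ => scaleShiftRate_negGeom zero_le_one (by norm_num) (by norm_num) γ,
      fun γ => bstar_zero_negGeom (by norm_num) (by norm_num) γ, fun γ => zeroHist_negGeom 1 (1 / 2) γ,
      fun δ => betaPartialSumsLowerH_negGeom zero_le_one (by norm_num) (by norm_num) δ⟩,
    ⟨fun k (v : Fin (k + 1) → ℝ) => -1 * v (Fin.last k) ^ 2, 1, one_pos, fun δ => histLipschitz_negSq zero_le_one,
      fun δ θ hδ hθ => fadingMemory_diag (by positivity) hθ, fun θ γ => scaleShiftRate_negSq 1 θ γ,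
      fun θ δ hθ0 hθ1 => bstar_zero_negSq zero_le_one hθ0 hθ1, fun θ δ hθ0 hθ1 => zeroHist_negSq zero_le_one hθ0 hθ1,
      fun δ hδ M => no_runPS_negSq one_pos hδ M⟩⟩
  have : (0 : ℝ) < (1 / 2 : ℝ) ^ k := by positivity
  show -1 * (1 / 2 : ℝ) ^ k < 0
  linarith

end

end Summit.QuantumFields.BalabanUV.Beta.EriceFlowEnclosureB12AsPrintedPointwiseFadingZeroHistoryBoundaryWitness
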